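import Summits.NavierStokesRegularity.NavierStokesRegularity.Theorems.AdaptedFrequencyTangentFlowTransferWindowExtractionTriple
import HarnessLib

/-!
# `C²_loc` compactness on expanding windows, II: the limit field and its class
# (route `AdaptedFrequency`, item `TangentFlowTransfer`, stmt-NavierStokesRegularity-10494)

Helper file (all results proved): the windowed, second-order twin of
`exists_tendsto_of_isTypeIAncientMild_seq` (`SqueezeCycleExtremalElementExistsExtraction`). Let
`w k` be jointly continuous on `(A_k, 0) × ℝ³`, weakly divergence free, Oseen-mild between all
times `A_k < s < t < 0` and Type-I bounded with a common constant `C`, where `A_k → −∞` (the zoomed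
blow-up sequence of a Type-I solution, made Oseen-mild by `mild_of_bounded_of_eLpNorm_two_le_of_lt`
and normalised to unit viscosity). Then along a subsequence `φ` the fields, their gradients
**and their second derivatives** converge locally uniformly on every slice `t < 0` to an ancient
field `W` of the Type-I class `IsTypeIAncientMild C` and to its derivatives
(`exists_tendsto_of_typeI_oseenMild_windows`):

1. on the compact pieces `[−(n+2), −1/(n+2)] × B̄(0, n+2)` the triples `(w k, ∇w k, ∇²w k)` are,
   for all large `k`, bounded and uniformly Lipschitz (the windowed class-uniform bounds on
   `w, ∇w, ∇²w, ∇³w` and the time-Lipschitz moduli of `w, ∇w, ∇²w`,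
   `AdaptedFrequencyTangentFlowTransferWindowRegularity`);
2. diagonal Arzelà–Ascoli (`exists_strictMono_tendstoUniformlyOn_of_bound`) on the triple maps;
   locally uniform limits of derivatives are derivatives (`hasFDerivAt_of_tendstoLocallyUniformlyOn`,
   twice);
3. Type-I bound, weak divergence-freeness and the Oseen equation pass to the limit along the
   tails `j ≥ j₀` on which the windows contain the times at hand, and `W ∈ IsTypeIAncientMild C`
   by `isTypeIAncientMild_of_continuous_oseenMild` (KNSS 2009, Prop. 4.1, Lemma 6.1).
-/

noncomputable section

-- third-order derivatives are triply nested continuous linear maps `E →L (E →L (E →L E))`, whose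
-- operator-norm instances need one more pending typeclass problem than the default allows
set_option maxSynthPendingDepth 2

open MeasureTheory Set Function Filter TopologicalSpace Metric
open scoped Topology NNReal ENNReal InnerProductSpace RealInnerProductSpace

namespace Summit.NavierStokesRegularity.NavierStokesRegularity.Theorems

open Literature.Analysis Literature.Analysis.FluidPDE

section Compactness

/-- **`C²_loc` compactness of Type-I Oseen-mild fields on expanding windows.** Let `A_k → −∞`
and let `w k : ℝ → ℝ³ → ℝ³` be jointly continuous on `(A_k, 0) × ℝ³`, weakly divergence free,
Oseen-mild (`w(t) = e^{(t−s)Δ}w(s) − B¹ₛ(w,w)(t)` for `A_k < s < t < 0`) and Type-I bounded with a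
common constant `C ≥ 0`. Then along some subsequence `φ` the slices `w (φ j) t`, their gradients
and their second derivatives converge locally uniformly, for every `t < 0`, to those of an ancient
field `W ∈ IsTypeIAncientMild C` (module docstring, steps 1–3). [cite: KochNadirashviliSereginSverak2009, Lemma 6.1 and Prop. 4.1 (arXiv:0709.3599 pp. 8, 11)] -/
theorem exists_tendsto_of_typeI_oseenMild_windows {C : ℝ} (hC : 0 ≤ C) {A : ℕ → ℝ}
    (hA : Tendsto A atTop atBot) {w : ℕ → ℝ → EuclideanSpace ℝ (Fin 3) → EuclideanSpace ℝ (Fin 3)}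
    (hc : ∀ k, ContinuousOn (uncurry (w k)) (Ioo (A k) 0 ×ˢ univ))
    (hdivw : ∀ k, ∀ t ∈ Ioo (A k) 0, IsWeaklyDivFree (w k t))
    (hmild : ∀ k, ∀ s t : ℝ, A k < s → s < t → t < 0 → ∀ x,
      w k t x = UnboundedOperators.heatExtension (w k s) (t - s) x - oseenDuhamel 1 s (w k) (w k) t x)
    (hI : ∀ k, ∀ t ∈ Ioo (A k) 0, ∀ x, ‖w k t x‖ ≤ C / Real.sqrt (-t)) :
    ∃ φ : ℕ → ℕ, StrictMono φ ∧
      ∃ W : ℝ → EuclideanSpace ℝ (Fin 3) → EuclideanSpace ℝ (Fin 3), IsTypeIAncientMild C W ∧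
        (∀ t < 0, TendstoLocallyUniformly (fun j => w (φ j) t) (W t) atTop) ∧
        (∀ t < 0, TendstoLocallyUniformly (fun j => fderiv ℝ (w (φ j) t)) (fderiv ℝ (W t)) atTop) ∧
        (∀ t < 0, TendstoLocallyUniformly (fun j => fderiv ℝ (fderiv ℝ (w (φ j) t)))
          (fderiv ℝ (fderiv ℝ (W t))) atTop) := by
  -- per-`k` facts on the windows
  have hsm : ∀ k, ContDiffOn ℝ (⊤ : ℕ∞) (uncurry (w k)) (Ioo (A k) 0 ×ˢ univ) := fun k =>
    contDiffOn_window_slab (hc k) (hdivw k) (hmild k) hC (hI k)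
  have hsmooth : ∀ k, ∀ t ∈ Ioo (A k) 0, ContDiff ℝ ((⊤ : ℕ∞) : WithTop ℕ∞) (w k t) := fun k t ht =>
    IsSmoothSpaceTimeOn.contDiff_slice (hsm k) ht
  have hdiff : ∀ k, ∀ t ∈ Ioo (A k) 0, Differentiable ℝ (w k t) := fun k t ht =>
    (hsmooth k t ht).differentiable (by simp)
  have hdiff2 : ∀ k, ∀ t ∈ Ioo (A k) 0, Differentiable ℝ (fderiv ℝ (w k t)) := fun k t ht =>
    ((hsmooth k t ht).fderiv_right (m := 1) (by norm_cast)).differentiable (by simp)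
  have hslice : ∀ k, ∀ t ∈ Ioo (A k) 0, Continuous (w k t) := fun k t ht => (hdiff k t ht).continuous
  -- ## Steps 1–3: the uniform convergence of the triples on the pieces
  obtain ⟨φ, hφ, W, G, Hs, hW0, hG0, hH0⟩ :=
    exists_tendstoUniformlyOn_triple_of_typeI_oseenMild_windows hC hA hc hdivw hmild hI
  set T : ℕ → Set (ℝ × EuclideanSpace ℝ (Fin 3)) := fun n =>
    Icc (-((n : ℝ) + 2)) (-(1 / ((n : ℝ) + 2))) ×ˢ closedBall (0 : EuclideanSpace ℝ (Fin 3)) ((n : ℝ) + 2)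
    with hT
  have hTneg : ∀ n, ∀ z ∈ T n, z.1 < 0 := fun n z hz => by
    obtain ⟨⟨h1, h2⟩, -⟩ := mem_slabPiece.1 hz
    have : (0 : ℝ) < 1 / ((n : ℝ) + 2) := by positivity
    linarith
  have hTlow : ∀ n, ∀ z ∈ T n, -((n : ℝ) + 2) ≤ z.1 := fun n z hz => (mem_slabPiece.1 hz).1.1
  have hφt : Tendsto φ atTop atTop := hφ.tendsto_atTop
  have hgoodφ : ∀ s : ℝ, ∀ᶠ j in atTop, A (φ j) < s := fun s =>
    (hA.comp hφt).eventually (eventually_lt_atBot s)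
  -- continuity of the limit on the open slab
  have hWc : ContinuousOn (uncurry W) (Iio 0 ×ˢ univ) := by
    have hVφ : ∀ n, ∀ᶠ j in atTop, ContinuousOn (fun z : ℝ × EuclideanSpace ℝ (Fin 3) => w (φ j) z.1 z.2)
        (T n) := fun n => by
      filter_upwards [hgoodφ (-((n : ℝ) + 2))] with j hj
      exact (hc (φ j)).mono fun z hz => ⟨⟨hj.trans_le (hTlow n z hz), hTneg n z hz⟩, mem_univ _⟩
    exact (continuousOn_slab_of_tendstoUniformlyOn hVφ hW0).congr fun z _ => rfl
  -- pointwise and slice-wise locally uniform convergence at the three levels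
  have hpt : ∀ t < 0, ∀ x, Tendsto (fun j => w (φ j) t x) atTop (𝓝 (W t x)) := fun t ht x =>
    tendsto_of_tendstoUniformlyOn_slabPiece hW0 ht x
  have hptG : ∀ t < 0, ∀ x, Tendsto (fun j => fderiv ℝ (w (φ j) t) x) atTop (𝓝 (G t x)) :=
    fun t ht x => tendsto_of_tendstoUniformlyOn_slabPiece hG0 ht x
  have hlu : ∀ t < 0, TendstoLocallyUniformly (fun j => w (φ j) t) (W t) atTop := fun t ht =>
    tendstoLocallyUniformly_slice_of_tendstoUniformlyOn_slabPiece hW0 ht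
  have hluG : ∀ t < 0, TendstoLocallyUniformly (fun j => fderiv ℝ (w (φ j) t)) (G t) atTop :=
    fun t ht => tendstoLocallyUniformly_slice_of_tendstoUniformlyOn_slabPiece hG0 ht
  have hluH : ∀ t < 0, TendstoLocallyUniformly (fun j => fderiv ℝ (fderiv ℝ (w (φ j) t))) (Hs t) atTop :=
    fun t ht => tendstoLocallyUniformly_slice_of_tendstoUniformlyOn_slabPiece hH0 ht
  -- the limits of the derivatives are the derivatives of the limits (along shifted tails)
  have hWD : ∀ t < 0, ∀ x, HasFDerivAt (W t) (G t x) x := fun t ht x => by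
    obtain ⟨j₀, hj₀⟩ := (hgoodφ t).exists_forall_of_atTop
    have hG0' : ∀ n, TendstoUniformlyOn (fun j z => fderiv ℝ (w (φ (j + j₀)) z.1) z.2) (fun z => G z.1 z.2)
        atTop (T n) := fun n => tendstoUniformlyOn_add_atTop (hG0 n) j₀
    have hluG' : TendstoLocallyUniformly (fun j => fderiv ℝ (w (φ (j + j₀)) t)) (G t) atTop :=
      tendstoLocallyUniformly_slice_of_tendstoUniformlyOn_slabPiece hG0' ht
    have hpt' : ∀ y, Tendsto (fun j => w (φ (j + j₀)) t y) atTop (𝓝 (W t y)) := fun y =>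
      (tendsto_add_atTop_iff_nat j₀).2 (hpt t ht y)
    refine hasFDerivAt_of_tendstoLocallyUniformlyOn isOpen_univ hluG'.tendstoLocallyUniformlyOn
      (fun j y _ => ?_) (fun y _ => hpt' y) (mem_univ x)
    exact ((hdiff (φ (j + j₀)) t ⟨hj₀ _ (Nat.le_add_left _ _), ht⟩) y).hasFDerivAt
  have hWG : ∀ t < 0, fderiv ℝ (W t) = G t := fun t ht => funext fun x => (hWD t ht x).fderiv
  have hGD : ∀ t < 0, ∀ x, HasFDerivAt (G t) (Hs t x) x := fun t ht x => by
    obtain ⟨j₀, hj₀⟩ := (hgoodφ t).exists_forall_of_atTop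
    have hH0' : ∀ n, TendstoUniformlyOn (fun j z => fderiv ℝ (fderiv ℝ (w (φ (j + j₀)) z.1)) z.2)
        (fun z => Hs z.1 z.2) atTop (T n) := fun n => tendstoUniformlyOn_add_atTop (hH0 n) j₀
    have hluH' : TendstoLocallyUniformly (fun j => fderiv ℝ (fderiv ℝ (w (φ (j + j₀)) t))) (Hs t) atTop :=
      tendstoLocallyUniformly_slice_of_tendstoUniformlyOn_slabPiece hH0' ht
    have hptG' : ∀ y, Tendsto (fun j => fderiv ℝ (w (φ (j + j₀)) t) y) atTop (𝓝 (G t y)) := fun y =>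
      (tendsto_add_atTop_iff_nat j₀).2 (hptG t ht y)
    refine hasFDerivAt_of_tendstoLocallyUniformlyOn isOpen_univ hluH'.tendstoLocallyUniformlyOn
      (fun j y _ => ?_) (fun y _ => hptG' y) (mem_univ x)
    exact ((hdiff2 (φ (j + j₀)) t ⟨hj₀ _ (Nat.le_add_left _ _), ht⟩) y).hasFDerivAt
  have hGH : ∀ t < 0, fderiv ℝ (G t) = Hs t := fun t ht => funext fun x => (hGD t ht x).fderiv
  have hWslice : ∀ t < 0, Continuous (W t) := fun t ht =>
    hWc.comp_continuous (continuous_const.prodMk continuous_id) fun x => ⟨ht, mem_univ x⟩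
  -- ## Step 4a: weak divergence-freeness of the limit slices
  have hWdiv : ∀ t < 0, IsWeaklyDivFree (W t) := by
    intro t ht θ hθ
    have hθ1 : ContDiff ℝ 1 θ := contDiff_infty.1 hθ.contDiff 1
    have hgc : HasCompactSupport (gradient θ) := by
      have : gradient θ = (fun L => (InnerProductSpace.toDual ℝ (EuclideanSpace ℝ (Fin 3))).symm L) ∘
          fderiv ℝ θ := rfl
      rw [this]
      exact (hθ.hasCompactSupport.fderiv (𝕜 := ℝ)).comp_left (by simp)
    set Mt : ℝ := C / Real.sqrt (-t) with hMt
    have hθi : Integrable (fun x => Mt * ‖gradient θ x‖) volume :=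
      (((continuous_gradient_of_contDiff hθ1).integrable_of_hasCompactSupport hgc).norm).const_mul Mt
    have hlimθ : Tendsto (fun j => ∫ x, ⟪w (φ j) t x, gradient θ x⟫_ℝ) atTop
        (𝓝 (∫ x, ⟪W t x, gradient θ x⟫_ℝ)) := by
      refine tendsto_integral_filter_of_dominated_convergence (fun x => Mt * ‖gradient θ x‖)
        ?_ ?_ hθi (Eventually.of_forall fun x => (hpt t ht x).inner tendsto_const_nhds)
      · filter_upwards [hgoodφ t] with j hj
        exact ((hslice (φ j) t ⟨hj, ht⟩).inner (continuous_gradient_of_contDiff hθ1)).aestronglyMeasurable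
      · filter_upwards [hgoodφ t] with j hj
        exact Eventually.of_forall fun x =>
          (norm_inner_le_norm _ _).trans
            (mul_le_mul_of_nonneg_right (hI (φ j) t ⟨hj, ht⟩ x) (norm_nonneg _))
    have hzero : ∀ᶠ j in atTop, ∫ x, ⟪w (φ j) t x, gradient θ x⟫_ℝ = 0 := by
      filter_upwards [hgoodφ t] with j hj using hdivw (φ j) t ⟨hj, ht⟩ θ hθ
    exact tendsto_nhds_unique hlimθ (tendsto_const_nhds.congr' (hzero.mono fun j hj => hj.symm))
  -- ## Step 4b: the Type-I bound of the limit
  have hWI : HasTypeITimeDecay C W := fun t ht x =>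
    le_of_tendsto (hpt t ht x).norm ((hgoodφ t).mono fun j hj => hI (φ j) t ⟨hj, ht⟩ x)
  -- ## Step 5: the Oseen identity in the limit (along a tail of the subsequence)
  have hWmild : ∀ s t : ℝ, s < t → t < 0 → ∀ x,
      W t x = UnboundedOperators.heatExtension (W s) (t - s) x - oseenDuhamel 1 s W W t x := by
    intro s t hst ht x
    have hs0 : s < 0 := hst.trans ht
    obtain ⟨j₀, hj₀⟩ := (hgoodφ s).exists_forall_of_atTop
    set u : ℕ → ℝ → EuclideanSpace ℝ (Fin 3) → EuclideanSpace ℝ (Fin 3) := fun j => w (φ (j + j₀)) with hu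
    have hAu : ∀ j, ∀ τ, s ≤ τ → τ < 0 → τ ∈ Ioo (A (φ (j + j₀))) 0 := fun j τ h1 h2 =>
      ⟨(hj₀ (j + j₀) (Nat.le_add_left _ _)).trans_le h1, h2⟩
    set M₀ : ℝ := C / Real.sqrt (-t) with hM₀
    have hM₀0 : 0 ≤ M₀ := by rw [hM₀]; positivity
    have huM : ∀ j, ∀ τ ∈ Ioo s t, ∀ y, ‖u j τ y‖ ≤ M₀ := fun j τ hτ y =>
      (hI _ τ (hAu j τ hτ.1.le (hτ.2.trans ht)) y).trans
        (div_sqrt_neg_le hC (neg_pos.2 ht) (by linarith [hτ.2]))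
    have hum : ∀ j, AEStronglyMeasurable (uncurry (u j))
        ((volume : Measure (ℝ × EuclideanSpace ℝ (Fin 3))).restrict (Ioo s t ×ˢ univ)) := fun j =>
      ((hc _).mono (prod_mono (fun τ hτ => hAu j τ hτ.1.le (hτ.2.trans ht)) Subset.rfl)).aestronglyMeasurable
        (measurableSet_Ioo.prod MeasurableSet.univ)
    have hWm : AEStronglyMeasurable (uncurry W)
        ((volume : Measure (ℝ × EuclideanSpace ℝ (Fin 3))).restrict (Ioo s t ×ˢ univ)) :=
      (hWc.mono (prod_mono (fun τ hτ => hτ.2.trans ht) Subset.rfl)).aestronglyMeasurable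
        (measurableSet_Ioo.prod MeasurableSet.univ)
    have hptu : ∀ τ < 0, ∀ y, Tendsto (fun j => u j τ y) atTop (𝓝 (W τ y)) := fun τ hτ y =>
      (tendsto_add_atTop_iff_nat j₀).2 (hpt τ hτ y)
    have hD : Tendsto (fun j => oseenDuhamel 1 s (u j) (u j) t x) atTop (𝓝 (oseenDuhamel 1 s W W t x)) :=
      tendsto_oseenDuhamel_of_tendsto_of_bound one_pos hM₀0 hst hum hWm huM
        (fun τ hτ y => hptu τ (hτ.2.trans ht) y) x
    have hH : Tendsto (fun j => UnboundedOperators.heatExtension (u j s) (t - s) x) atTop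
        (𝓝 (UnboundedOperators.heatExtension (W s) (t - s) x)) :=
      tendsto_heatExtension_of_tendsto_of_bound (M := C / Real.sqrt (-s))
        (fun j => (hslice _ s (hAu j s le_rfl hs0)).aestronglyMeasurable)
        (fun j z => hI _ s (hAu j s le_rfl hs0) z) (hptu s hs0) (sub_pos.2 hst) x
    have hid : (fun j => u j t x) = fun j =>
        UnboundedOperators.heatExtension (u j s) (t - s) x - oseenDuhamel 1 s (u j) (u j) t x :=
      funext fun j => hmild _ s t (hAu j s le_rfl hs0).1 hst ht x
    have hlim2 : Tendsto (fun j => u j t x) atTop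
        (𝓝 (UnboundedOperators.heatExtension (W s) (t - s) x - oseenDuhamel 1 s W W t x)) := by
      rw [hid]; exact hH.sub hD
    exact tendsto_nhds_unique (hptu t ht x) hlim2
  -- ## Conclusion
  have hWclass : IsTypeIAncientMild C W := isTypeIAncientMild_of_continuous_oseenMild hWc hWdiv hWmild hWI
  refine ⟨φ, hφ, W, hWclass, hlu, fun t ht => ?_, fun t ht => ?_⟩
  · rw [hWG t ht]; exact hluG t ht
  · rw [hWG t ht, hGH t ht]; exact hluH t ht

end Compactness

end Summit.NavierStokesRegularity.NavierStokesRegularity.Theorems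

end
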